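import Summits.AtomisticToContinuum.Crystallization.Theses.ThreeConeCertificate
import Summits.AtomisticToContinuum.Crystallization.Theorems.ThreeConeCertificateExactCertificateNoGapPeriodic
import Summits.AtomisticToContinuum.Crystallization.Theorems.ThreeConeCertificateExactCertificatePeriodicMinimum

/-!
# `ExactCertificate` (stmt-AtomisticToContinuum-11959): the design of line `Ideator5Sketch`
# (`robust-soft-flyspeck`) forces the periodic minimum — registered stub `stub_designForcesKeplerBound`

Line `Ideator5Sketch` (crux-ideate round 2, ideator 5; card `robust-soft-flyspeck`), line lead a1.  Its
composition target (`stub_composition`) builds the crux from a DESIGN: a template `P₀`, a range `ρ`, a radial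
positive-type `f` dominated by `V_LJ` on `[ρ,∞) ∩ (0,∞)`, and the periodic core bound
`∀ Q periodic, e_LJ(P₀) + f 0/2 ≤ e_Q(g_f)` for the designed finite-range core `g_f := (V_LJ − f)·1_{(0,ρ)}`
(to be certified, on the card, by a one-centre inequality with zero-sum transfers).  This file says where
that leaves the line:

* `energyPerParticle_eq_eStar_of_coreBound`: the core bound forces `e_LJ(P₀) = e*` — by
  `NoGap.periodicInf_core_le` the periodic infimum of `e_·(g_f)` is never above `e* + f 0/2`, so
  `e_LJ(P₀) ≤ e*`, and `e* ≤ e_LJ(P₀)` always (`eStar_le`).  The template MUST be a periodic minimiser of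
  the Lennard-Jones energy per particle.
* `stub_designForcesKeplerBound` (registered signature verbatim): hence the design gives route item 11961
  `KeplerBound` (`keplerBound_of_periodicMinimum`; `↔` shared item 0627 `↔ HasPeriodicGroundStateEnergy V_LJ 3`,
  conjunct (i) of the sub-problem — open, Blanc–Lewin 2015 §2.3).
* `coreDesign_iff_exactCertificate`: the design statement, existentially closed, is EQUIVALENT to the crux
  (`NoGap.exactCertificate_iff_sharpSplit_and_periodicMinimum` + `NoGap.stub_sharpSplitPeriodic`): the
  line's content stub is the crux in normal form, not a weakening of it.
* `coreDesign_iff_sharpSplitPeriodic_and_periodicMinimum`: and it factors exactly as the dead line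
  `closure-makes-nogap-exact` did — (periodic-only `SharpSplit`) ∧ (periodic minimum attained).

All `[folklore]` (order bookkeeping over landed tree theorems).
-/

noncomputable section

namespace Summit.AtomisticToContinuum.Crystallization.Theorems.ThreeConeCertificateExactCertificate.Design

open Literature.MathematicalPhysics.StatisticalMechanics
open Summit.AtomisticToContinuum.Crystallization.Theses.ThreeConeCertificate
open Summit.AtomisticToContinuum.Crystallization.Theorems.ChargedEnergyGapNegative (eStar eStar_le)
open Summit.AtomisticToContinuum.Crystallization.Theorems.ThreeConeCertificateExactCertificate.NoGap
  (periodicInf_core_le stub_sharpSplitPeriodic exactCertificate_iff_sharpSplit_and_periodicMinimum)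
open scoped BigOperators

/-- **The periodic core bound forces `e_LJ(P₀) = e*`.**  If `f` is radially of positive type with
`f ≤ V_LJ` on `[ρ,∞) ∩ (0,∞)` and `e_LJ(P₀) + f 0/2 ≤ e_Q((V_LJ − f)1_{(0,ρ)})` for every periodic `Q`, then
`P₀` attains the periodic infimum `e*` of the Lennard-Jones energy per particle: the periodic infimum of the
designed core is `≤ e* + f 0/2` (`NoGap.periodicInf_core_le`), and `e* ≤ e_LJ(P₀)` (`eStar_le`). [folklore] -/
theorem energyPerParticle_eq_eStar_of_coreBound {P₀ : PeriodicConfiguration 3} {ρ : ℝ} {f : ℝ → ℝ}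
    (hpd : ∀ (n : ℕ) (y : Fin n → EuclideanSpace ℝ (Fin 3)) (w : Fin n → ℝ),
      0 ≤ ∑ i, ∑ j, w i * w j * f (dist (y i) (y j)))
    (htail : ∀ r : ℝ, ρ ≤ r → 0 < r → f r ≤ lennardJones r)
    (hcore : ∀ Q : PeriodicConfiguration 3,
      P₀.energyPerParticle lennardJones + f 0 / 2 ≤
        Q.energyPerParticle (fun r => if r < ρ then lennardJones r - f r else 0)) :
    P₀.energyPerParticle lennardJones = eStar := by
  refine le_antisymm (le_of_forall_pos_lt_add fun ε hε => ?_) (eStar_le P₀)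
  obtain ⟨Q, hQ⟩ := periodicInf_core_le hpd htail hε
  have h := hcore Q
  linarith

/-- **Hence the template is a periodic minimiser**: `e_LJ(P₀) ≤ e_LJ(Q)` for every periodic `Q`
(the registered signature of the dead line's `stub_periodicMinimum`, witnessed by `P₀`). [folklore] -/
theorem periodicMinimum_of_coreBound {P₀ : PeriodicConfiguration 3} {ρ : ℝ} {f : ℝ → ℝ}
    (hpd : ∀ (n : ℕ) (y : Fin n → EuclideanSpace ℝ (Fin 3)) (w : Fin n → ℝ),
      0 ≤ ∑ i, ∑ j, w i * w j * f (dist (y i) (y j)))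
    (htail : ∀ r : ℝ, ρ ≤ r → 0 < r → f r ≤ lennardJones r)
    (hcore : ∀ Q : PeriodicConfiguration 3,
      P₀.energyPerParticle lennardJones + f 0 / 2 ≤
        Q.energyPerParticle (fun r => if r < ρ then lennardJones r - f r else 0)) :
    ∃ P : PeriodicConfiguration 3, ∀ Q : PeriodicConfiguration 3,
      P.energyPerParticle lennardJones ≤ Q.energyPerParticle lennardJones :=
  ⟨P₀, fun Q => by
    rw [energyPerParticle_eq_eStar_of_coreBound hpd htail hcore]
    exact eStar_le Q⟩

/-- **Registered stub `stub_designForcesKeplerBound` of crux item stmt-AtomisticToContinuum-11959 (line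
`Ideator5Sketch`; signature verbatim): the hypotheses of the line's composition target already give route
item 11961 `KeplerBound`** — the design's template is a periodic minimiser (`periodicMinimum_of_coreBound`),
and a periodic minimiser gives the finite-`N` Kepler bound (`keplerBound_of_periodicMinimum`).  So this line,
like every line for the crux (`keplerBound_of_exactCertificate`), carries the open item 11961 ↔ 0627. [folklore] -/
theorem stub_designForcesKeplerBound : ∀ (P₀ : PeriodicConfiguration 3) (ρ : ℝ) (f : ℝ → ℝ),
    (∀ (n : ℕ) (y : Fin n → EuclideanSpace ℝ (Fin 3)) (w : Fin n → ℝ),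
      0 ≤ ∑ i, ∑ j, w i * w j * f (dist (y i) (y j))) →
    (∀ r : ℝ, ρ ≤ r → 0 < r → f r ≤ lennardJones r) →
    (∀ Q : PeriodicConfiguration 3,
      P₀.energyPerParticle lennardJones + f 0 / 2 ≤
        Q.energyPerParticle (fun r => if r < ρ then lennardJones r - f r else 0)) →
    KeplerBound :=
  fun _ _ _ hpd htail hcore => keplerBound_of_periodicMinimum (periodicMinimum_of_coreBound hpd htail hcore)

/-- **The design statement factors exactly as the dead line did**: a design `(P₀, ρ, f)` with the periodic
core bound exists iff (periodic-only `SharpSplit`: some `(ρ, f)` has `e* + f 0/2 ≤ e_Q(g_f)` for all periodic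
`Q`) and (the periodic infimum `e*` of `e_LJ` is attained).  `→`: the template attains `e*`
(`energyPerParticle_eq_eStar_of_coreBound`); `←`: use the minimiser as template. [folklore] -/
theorem coreDesign_iff_sharpSplitPeriodic_and_periodicMinimum :
    (∃ (P₀ : PeriodicConfiguration 3) (ρ : ℝ) (f : ℝ → ℝ),
      (∀ (n : ℕ) (y : Fin n → EuclideanSpace ℝ (Fin 3)) (w : Fin n → ℝ),
        0 ≤ ∑ i, ∑ j, w i * w j * f (dist (y i) (y j))) ∧
      (∀ r : ℝ, ρ ≤ r → 0 < r → f r ≤ lennardJones r) ∧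
      ∀ Q : PeriodicConfiguration 3,
        P₀.energyPerParticle lennardJones + f 0 / 2 ≤
          Q.energyPerParticle (fun r => if r < ρ then lennardJones r - f r else 0)) ↔
    (∃ (ρ : ℝ) (f : ℝ → ℝ),
      (∀ (n : ℕ) (y : Fin n → EuclideanSpace ℝ (Fin 3)) (w : Fin n → ℝ),
        0 ≤ ∑ i, ∑ j, w i * w j * f (dist (y i) (y j))) ∧
      (∀ r : ℝ, ρ ≤ r → 0 < r → f r ≤ lennardJones r) ∧
      ∀ Q : PeriodicConfiguration 3,
        eStar + f 0 / 2 ≤ Q.energyPerParticle (fun r => if r < ρ then lennardJones r - f r else 0)) ∧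
    (∃ P : PeriodicConfiguration 3, ∀ Q : PeriodicConfiguration 3,
      P.energyPerParticle lennardJones ≤ Q.energyPerParticle lennardJones) := by
  constructor
  · rintro ⟨P₀, ρ, f, hpd, htail, hcore⟩
    have he := energyPerParticle_eq_eStar_of_coreBound hpd htail hcore
    exact ⟨⟨ρ, f, hpd, htail, fun Q => he ▸ hcore Q⟩, periodicMinimum_of_coreBound hpd htail hcore⟩
  · rintro ⟨⟨ρ, f, hpd, htail, hQ⟩, ⟨P, hP⟩⟩
    have he : P.energyPerParticle lennardJones = eStar := le_antisymm (le_ciInf hP) (eStar_le P)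
    exact ⟨P, ρ, f, hpd, htail, fun Q => he ▸ hQ Q⟩

/-- **The design statement IS the crux**: a design `(P₀, ρ, f)` — radial positive-type `f` dominated by
`V_LJ` beyond `ρ`, with the periodic core bound `e_LJ(P₀) + f 0/2 ≤ e_Q((V_LJ − f)1_{(0,ρ)})` for every
periodic `Q` — exists iff `ExactCertificate` holds (tree: `ExactCertificate ↔ SharpSplit ∧ PeriodicMinimum`,
`SharpSplit ↔` its periodic-only form).  The content stub of line `Ideator5Sketch` is therefore the crux in
normal form; what the card adds (bounded-radius transfers, a compact jet family) restricts HOW the core bound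
is to be certified, not WHAT must hold. [folklore] -/
theorem coreDesign_iff_exactCertificate :
    (∃ (P₀ : PeriodicConfiguration 3) (ρ : ℝ) (f : ℝ → ℝ),
      (∀ (n : ℕ) (y : Fin n → EuclideanSpace ℝ (Fin 3)) (w : Fin n → ℝ),
        0 ≤ ∑ i, ∑ j, w i * w j * f (dist (y i) (y j))) ∧
      (∀ r : ℝ, ρ ≤ r → 0 < r → f r ≤ lennardJones r) ∧
      ∀ Q : PeriodicConfiguration 3,
        P₀.energyPerParticle lennardJones + f 0 / 2 ≤
          Q.energyPerParticle (fun r => if r < ρ then lennardJones r - f r else 0)) ↔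
    ExactCertificate := by
  rw [coreDesign_iff_sharpSplitPeriodic_and_periodicMinimum, exactCertificate_iff_sharpSplit_and_periodicMinimum,
    stub_sharpSplitPeriodic]

/-- **Corollary: the design hypotheses give `KeplerBound` and the crux gives them back** — in particular
`ExactCertificate → KeplerBound` re-derived through the design normal form (cf. the route's
`certificateBound_proof`). [folklore] -/
theorem keplerBound_of_coreDesign
    (h : ∃ (P₀ : PeriodicConfiguration 3) (ρ : ℝ) (f : ℝ → ℝ),
      (∀ (n : ℕ) (y : Fin n → EuclideanSpace ℝ (Fin 3)) (w : Fin n → ℝ),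
        0 ≤ ∑ i, ∑ j, w i * w j * f (dist (y i) (y j))) ∧
      (∀ r : ℝ, ρ ≤ r → 0 < r → f r ≤ lennardJones r) ∧
      ∀ Q : PeriodicConfiguration 3,
        P₀.energyPerParticle lennardJones + f 0 / 2 ≤
          Q.energyPerParticle (fun r => if r < ρ then lennardJones r - f r else 0)) :
    KeplerBound := by
  obtain ⟨P₀, ρ, f, hpd, htail, hcore⟩ := h
  exact stub_designForcesKeplerBound P₀ ρ f hpd htail hcore

end Summit.AtomisticToContinuum.Crystallization.Theorems.ThreeConeCertificateExactCertificate.Design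

end
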